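import Summits.BirchSwinnertonDyer.BirchSwinnertonDyer.Theorems.ClassRecordThreeEulerHalvesAtThreeCartanCoverPrintClausesFinitelyGenerated
import HarnessLib

/-!
# Crux `EulerHalvesAtThree` (item 19109) — print residue (SIGᶜ)(ii) `parabolicCochain_modLift`: REDUCTION TO PRIME MODULI, and the
# LIFTING ENGINE «clause (i) basis + an `𝔽_p`-dimension bound ⇒ the lift mod `p`»

Seat `bsd-idea-10` g24 (lens transfer; `--supports stmt-BirchSwinnertonDyer-19109 --as helper`). Pure group ∕ module algebra, no modular input.
The named print fact (SIGᶜ)(ii) `Literature.NumberTheory.Automorphic.parabolicCochain_modLift` says: for `Γ = ι(O¹)` and EVERY `n ≠ 0`, every additive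
`ψ : Γ → ZMod n` killing the elements of finite order and the parabolic elements lifts to an additive parabolic-null `u : Γ → ℤ`. This file proves, for an
ARBITRARY group `G` and an ARBITRARY «null» predicate `P : G → Prop` (here: `γ ↦ (γ : GL₂(ℝ)).IsParabolic`):

* §1 `additive_eq_zero_of_isOfFinOrder`: an additive `u : G → ℤ` kills every element of finite order (so integral lifts are automatically torsion-null).
* §2 `modLift_mul` ∕ `modLift_of_prime`: the lifting property at all `n ≠ 0` follows from the prime moduli alone — one prime `p ∣ n` at a
  time: lift `ψ mod p`, subtract, divide the integral defect by `p`, recurse on `n ∕ p` (strong induction).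
* §3 `modLift_of_basis`: at a prime `p`, if the additive `P`-null maps `G → ℤ` have a finite `ℤ`-basis `e₁ … e_r` with unique coefficients (EXACTLY the
  shape of clause (SIGᶜ)(i), a theorem in the tree: `CartanCover.PrintClauses.sigBasisClause`) and every `𝔽_p`-linearly independent family of additive,
  torsion-null, `P`-null maps `G → ZMod p` has at most `r` members, then the lifting property holds at `p`: the reductions `ē₁ … ē_r` are `𝔽_p`-independent (a relation
  lifts to an element of `p · L`, whose coefficients are unique), hence a maximal independent family, hence span; integral lifts of the coefficients give `u`.
  `card_le_of_linearIndependent_int`: conversely-shaped bookkeeping — `t` `ℤ`-independent additive `P`-null maps force `t ≤ r`.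
* §4 the corollaries for (SIGᶜ)(ii) verbatim: `parabolicCochain_modLift_of_prime` (all `n` ⇐ prime `n`) and `parabolicCochain_modLift_of_rankBound`
  ((SIGᶜ)(ii) ⇐ «for every `(B, O, ι)` and prime `p`: `dim_{𝔽_p} {additive, torsion-null, parabolic-null maps ι(O¹) → 𝔽_p} ≤ rank_ℤ Hom_par(ι(O¹), ℤ)`»),
  the rank being read through `sigBasisClause`.

What this is for (successor plan, dossier `Cruxes/EulerHalvesAtThree/Lines/es-surj-gamma-transfer.md` §6): at a SPLIT algebra the remaining input is the
single inequality `dim_{𝔽_p} V_p(Γ) ≤ rank_ℤ L(Γ)` for `Γ ∋ -1` of finite index in `SL₂(ℤ)`, i.e. the `𝔽_p`-version (with the torsion refinement at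
`p = 2, 3`) of the general-level Shimura count `…EichlerShimuraLevelCountC/E` together with `2g` independent INTEGRAL parabolic cocycles. Nothing here is
specific to quaternion orders; nothing is proved about 19109, 24801 or any curve; BSD is proved for no curve.
[cite: ShimuraIATAF1971, §8.1 (8.1.4)–(8.1.6), §8.2 (8.2.6) p. 232] [cite: Brown1982, III.1 Ex. 2] [cite: Iwaniec2002, Ch. 2 Prop. 2.6]
-/

set_option linter.dupNamespace false
set_option autoImplicit false

noncomputable section

open Function

namespace Summit.BirchSwinnertonDyer.BirchSwinnertonDyer.Theorems.EichlerShimuraModLift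

variable {G : Type*}

/-! ## §0 Generalities (no group structure needed): reduction mod `p`, null combinations -/

/-- Reduction mod `p` of an integer-valued map. [folklore] -/
def red (p : ℕ) (u : G → ℤ) : G → ZMod p := fun γ ↦ (u γ : ZMod p)

/-- `red` evaluated. [folklore] -/
@[simp] theorem red_apply (p : ℕ) (u : G → ℤ) (γ : G) : red p u γ = (u γ : ZMod p) := rfl

/-- The reduction of the integral combination `∑ (c i).val · e i` is the `𝔽_p`-combination `∑ c i • red (e i)`. [folklore] -/
theorem red_sum_val {p : ℕ} [NeZero p] {r : ℕ} (e : Fin r → G → ℤ) (c : Fin r → ZMod p) (γ : G) :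
    (((∑ i, ((c i).val : ℤ) * e i γ : ℤ)) : ZMod p) = (∑ i, c i • red p (e i)) γ := by
  rw [Finset.sum_apply]
  push_cast
  refine Finset.sum_congr rfl fun i _ ↦ ?_
  rw [Pi.smul_apply, smul_eq_mul, red_apply, ZMod.natCast_zmod_val]

/-- A `ℤ`-linear combination of `P`-null maps is `P`-null. [folklore] -/
theorem null_sum (P : G → Prop) {r : ℕ} {e : Fin r → G → ℤ} (he : ∀ i, ∀ γ : G, P γ → e i γ = 0) (c : Fin r → ℤ) :
    ∀ γ : G, P γ → (∑ i, c i * e i γ) = 0 := fun γ hγ ↦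
  Finset.sum_eq_zero fun i _ ↦ by rw [he i γ hγ, mul_zero]

variable [Group G]

/-! ## §1 Additive integer-valued maps kill torsion -/

/-- An additive map `u : G → ℤ` sends `1` to `0`. [folklore] -/
theorem additive_map_one {u : G → ℤ} (hu : ∀ γ δ : G, u (γ * δ) = u γ + u δ) : u 1 = 0 := by
  have h := hu 1 1
  rw [mul_one] at h
  linarith

/-- An additive map `u : G → ℤ` satisfies `u (γ ^ k) = k · u γ`. [folklore] -/
theorem additive_map_pow {u : G → ℤ} (hu : ∀ γ δ : G, u (γ * δ) = u γ + u δ) (γ : G) (k : ℕ) :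
    u (γ ^ k) = (k : ℤ) * u γ := by
  induction k with
  | zero => simp [additive_map_one hu]
  | succ k ih => rw [pow_succ, hu, ih]; push_cast; ring

/-- **An additive map `u : G → ℤ` kills every element of finite order** (`ℤ` is torsion-free). [cite: Brown1982, III.1 Ex. 2] -/
theorem additive_eq_zero_of_isOfFinOrder {u : G → ℤ} (hu : ∀ γ δ : G, u (γ * δ) = u γ + u δ) {γ : G}
    (hγ : IsOfFinOrder γ) : u γ = 0 := by
  obtain ⟨k, hk, hγk⟩ := (isOfFinOrder_iff_pow_eq_one).1 hγ
  have h := additive_map_pow hu γ k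
  rw [hγk, additive_map_one hu] at h
  have hk' : (k : ℤ) ≠ 0 := by exact_mod_cast hk.ne'
  rcases mul_eq_zero.1 h.symm with h0 | h0
  · exact absurd h0 hk'
  · exact h0

/-- A `ℤ`-linear combination of additive maps is additive. [folklore] -/
theorem additive_sum {r : ℕ} {e : Fin r → G → ℤ} (he : ∀ i, ∀ γ δ : G, e i (γ * δ) = e i γ + e i δ) (c : Fin r → ℤ) :
    ∀ γ δ : G, (∑ i, c i * e i (γ * δ)) = (∑ i, c i * e i γ) + ∑ i, c i * e i δ := by
  intro γ δ
  rw [← Finset.sum_add_distrib]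
  exact Finset.sum_congr rfl fun i _ ↦ by rw [he i, mul_add]

/-! ## §2 The lifting property, and its reduction to prime moduli -/

/-- **The multiplicative step**: the lifting property at a prime `p` and at `m` give it at `p * m` — lift `ψ mod p` to `u₁`, write the integral
defect `ψ̃ - u₁ = p · g`, observe that `g mod m` is again additive, torsion-null and `P`-null, lift it to `u₂`, and take `u = u₁ + p · u₂`.
(The lifting property at `n` for `G = ι(O¹)`, `P = IsParabolic ∘ (↑)` is the `(B, O, ι, n)`-instance of (SIGᶜ)(ii) `parabolicCochain_modLift`.)
[cite: ShimuraIATAF1971, §8.2 (8.2.6) p. 232] -/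
theorem modLift_mul (P : G → Prop) {p m : ℕ} (hp : p.Prime) (hm : m ≠ 0)
    (hlp : ∀ ψ : G → ZMod p,
      (∀ γ δ : G, ψ (γ * δ) = ψ γ + ψ δ) → (∀ γ : G, IsOfFinOrder γ → ψ γ = 0) → (∀ γ : G, P γ → ψ γ = 0) →
      ∃ u : G → ℤ, (∀ γ δ : G, u (γ * δ) = u γ + u δ) ∧ (∀ γ : G, P γ → u γ = 0) ∧ ∀ γ : G, (u γ : ZMod p) = ψ γ)
    (hlm : ∀ ψ : G → ZMod m,
      (∀ γ δ : G, ψ (γ * δ) = ψ γ + ψ δ) → (∀ γ : G, IsOfFinOrder γ → ψ γ = 0) → (∀ γ : G, P γ → ψ γ = 0) →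
      ∃ u : G → ℤ, (∀ γ δ : G, u (γ * δ) = u γ + u δ) ∧ (∀ γ : G, P γ → u γ = 0) ∧ ∀ γ : G, (u γ : ZMod m) = ψ γ) :
    ∀ ψ : G → ZMod (p * m),
      (∀ γ δ : G, ψ (γ * δ) = ψ γ + ψ δ) → (∀ γ : G, IsOfFinOrder γ → ψ γ = 0) → (∀ γ : G, P γ → ψ γ = 0) →
      ∃ u : G → ℤ, (∀ γ δ : G, u (γ * δ) = u γ + u δ) ∧ (∀ γ : G, P γ → u γ = 0) ∧ ∀ γ : G, (u γ : ZMod (p * m)) = ψ γ := by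
  intro ψ hadd htors hpar
  haveI : NeZero (p * m) := ⟨Nat.mul_ne_zero hp.ne_zero hm⟩
  haveI : NeZero m := ⟨hm⟩
  haveI : Fact p.Prime := ⟨hp⟩
  have hp0 : (p : ℤ) ≠ 0 := by exact_mod_cast hp.ne_zero
  -- Step 1: reduce mod `p` and lift.
  set π : ZMod (p * m) →+* ZMod p := ZMod.castHom (dvd_mul_right p m) (ZMod p) with hπ
  obtain ⟨u₁, hu₁, hu₁P, hu₁ψ⟩ := hlp (fun γ ↦ π (ψ γ)) (fun γ δ ↦ by rw [hadd, map_add])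
    (fun γ hγ ↦ by rw [htors γ hγ, map_zero]) (fun γ hγ ↦ by rw [hpar γ hγ, map_zero])
  -- Step 2: the integral defect is divisible by `p`.
  set f : G → ℤ := fun γ ↦ ((ψ γ).val : ℤ) - u₁ γ with hf
  have hval : ∀ γ : G, (((ψ γ).val : ℤ) : ZMod (p * m)) = ψ γ := fun γ ↦ by
    rw [Int.cast_natCast, ZMod.natCast_zmod_val]
  have hval' : ∀ γ : G, (((ψ γ).val : ℕ) : ZMod (p * m)) = ψ γ := fun γ ↦ ZMod.natCast_zmod_val _
  have hvalp : ∀ γ : G, (((ψ γ).val : ℕ) : ZMod p) = π (ψ γ) := fun γ ↦ by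
    rw [ZMod.natCast_val, hπ, ZMod.castHom_apply]
  have hpf : ∀ γ : G, (p : ℤ) ∣ f γ := fun γ ↦ by
    rw [← ZMod.intCast_zmod_eq_zero_iff_dvd, hf]
    push_cast
    rw [hvalp, hu₁ψ, sub_self]
  set g : G → ℤ := fun γ ↦ f γ / p with hg
  have hfg : ∀ γ : G, f γ = p * g γ := fun γ ↦ (Int.mul_ediv_cancel' (hpf γ)).symm
  -- the defect is additive mod `p * m` and vanishes on torsion and on `P`
  have hfadd : ∀ γ δ : G, ((p * m : ℕ) : ℤ) ∣ f γ + f δ - f (γ * δ) := fun γ δ ↦ by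
    rw [← ZMod.intCast_zmod_eq_zero_iff_dvd, hf]
    push_cast
    rw [hval', hval', hval', hadd, hu₁]
    push_cast
    ring
  have hf0_tors : ∀ γ : G, IsOfFinOrder γ → f γ = 0 := fun γ hγ ↦ by
    simp only [hf, htors γ hγ, ZMod.val_zero, Nat.cast_zero, additive_eq_zero_of_isOfFinOrder hu₁ hγ, sub_zero]
  have hf0_par : ∀ γ : G, P γ → f γ = 0 := fun γ hγ ↦ by
    simp only [hf, hpar γ hγ, ZMod.val_zero, Nat.cast_zero, hu₁P γ hγ, sub_zero]
  have hg0_of : ∀ γ : G, f γ = 0 → g γ = 0 := fun γ h ↦ by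
    have := hfg γ
    rw [h] at this
    rcases mul_eq_zero.1 this.symm with h' | h'
    · exact absurd h' hp0
    · exact h'
  -- Step 3: `g mod m` is additive, torsion-null, `P`-null; lift it.
  have hgadd : ∀ γ δ : G, ((g (γ * δ) : ℤ) : ZMod m) = g γ + g δ := fun γ δ ↦ by
    rw [← Int.cast_add, ZMod.intCast_eq_intCast_iff_dvd_sub]
    have h1 := hfadd γ δ
    rw [hfg, hfg, hfg, ← mul_add, ← mul_sub, Nat.cast_mul] at h1
    exact (mul_dvd_mul_iff_left hp0).1 h1
  obtain ⟨u₂, hu₂, hu₂P, hu₂g⟩ := hlm (fun γ ↦ (g γ : ZMod m)) hgadd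
    (fun γ hγ ↦ by rw [hg0_of γ (hf0_tors γ hγ), Int.cast_zero]) (fun γ hγ ↦ by rw [hg0_of γ (hf0_par γ hγ), Int.cast_zero])
  -- Step 4: assemble.
  refine ⟨fun γ ↦ u₁ γ + p * u₂ γ, fun γ δ ↦ by dsimp only; rw [hu₁, hu₂]; ring,
    fun γ hγ ↦ by dsimp only; rw [hu₁P γ hγ, hu₂P γ hγ]; ring, fun γ ↦ ?_⟩
  dsimp only
  rw [← hval γ, ZMod.intCast_eq_intCast_iff_dvd_sub]
  have h2 : ((m : ℕ) : ℤ) ∣ g γ - u₂ γ := by rw [← ZMod.intCast_eq_intCast_iff_dvd_sub]; exact hu₂g γ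
  have h3 : ((ψ γ).val : ℤ) - (u₁ γ + p * u₂ γ) = p * (g γ - u₂ γ) := by rw [mul_sub, ← hfg]; simp only [hf]; ring
  rw [h3, Nat.cast_mul]
  exact mul_dvd_mul_left _ h2

/-- **REDUCTION TO PRIME MODULI**: if the lifting property holds at every prime `p`, it holds at every `n ≠ 0` (strong induction on `n`, one
prime factor at a time, `modLift_mul`). [cite: ShimuraIATAF1971, §8.2 (8.2.6) p. 232] -/
theorem modLift_of_prime (P : G → Prop)
    (hprime : ∀ p : ℕ, p.Prime → ∀ ψ : G → ZMod p,
        (∀ γ δ : G, ψ (γ * δ) = ψ γ + ψ δ) → (∀ γ : G, IsOfFinOrder γ → ψ γ = 0) → (∀ γ : G, P γ → ψ γ = 0) →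
        ∃ u : G → ℤ, (∀ γ δ : G, u (γ * δ) = u γ + u δ) ∧ (∀ γ : G, P γ → u γ = 0) ∧ ∀ γ : G, (u γ : ZMod p) = ψ γ)
    (n : ℕ) (hn : n ≠ 0) :
    ∀ ψ : G → ZMod n,
      (∀ γ δ : G, ψ (γ * δ) = ψ γ + ψ δ) → (∀ γ : G, IsOfFinOrder γ → ψ γ = 0) → (∀ γ : G, P γ → ψ γ = 0) →
      ∃ u : G → ℤ, (∀ γ δ : G, u (γ * δ) = u γ + u δ) ∧ (∀ γ : G, P γ → u γ = 0) ∧ ∀ γ : G, (u γ : ZMod n) = ψ γ := by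
  induction n using Nat.strong_induction_on with
  | _ n ih =>
    by_cases h1 : n = 1
    · subst h1
      exact fun _ _ _ _ ↦ ⟨0, fun _ _ ↦ by simp, fun _ _ ↦ rfl, fun _ ↦ Subsingleton.elim _ _⟩
    obtain ⟨p, hp, m, rfl⟩ := Nat.exists_prime_and_dvd h1
    have hm : m ≠ 0 := by rintro rfl; exact hn (mul_zero p)
    have hlt : m < p * m := by nlinarith [hp.two_le, Nat.pos_of_ne_zero hm]
    exact modLift_mul P hp hm (hprime p hp) (ih m hlt hm)

/-! ## §3 The lifting engine at a prime: a `ℤ`-basis of the `P`-null additive maps and an `𝔽_p`-dimension bound -/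

section Engine

variable (P : G → Prop) {p : ℕ} [Fact p.Prime] {r : ℕ} (e : Fin r → G → ℤ)

/-- **The reductions of a clause-(i) basis are `𝔽_p`-linearly independent**: a relation `∑ c i • ē i = 0` lifts to `w = ∑ c̃ i · e i ∈ p · (G → ℤ)`,
`w ∕ p` is again additive and `P`-null, so has coefficients `d`; uniqueness of the coefficients of `w` gives `c̃ = p · d`, i.e. `c = 0`.
[cite: ShimuraIATAF1971, §8.1 (8.1.4)–(8.1.6)] -/
theorem linearIndependent_red (he : ∀ i, (∀ γ δ : G, e i (γ * δ) = e i γ + e i δ) ∧ ∀ γ : G, P γ → e i γ = 0)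
    (huniq : ∀ u : G → ℤ, (∀ γ δ : G, u (γ * δ) = u γ + u δ) → (∀ γ : G, P γ → u γ = 0) →
      ∃! c : Fin r → ℤ, u = fun γ ↦ ∑ i, c i * e i γ) :
    LinearIndependent (ZMod p) (fun i ↦ red p (e i)) := by
  have hp : p.Prime := Fact.out
  have hp0 : (p : ℤ) ≠ 0 := by exact_mod_cast hp.ne_zero
  rw [Fintype.linearIndependent_iff]
  intro c hc i
  set ct : Fin r → ℤ := fun i ↦ ((c i).val : ℤ) with hct
  set w : G → ℤ := fun γ ↦ ∑ i, ct i * e i γ with hw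
  have hwadd : ∀ γ δ : G, w (γ * δ) = w γ + w δ := additive_sum (fun i ↦ (he i).1) ct
  have hwP : ∀ γ : G, P γ → w γ = 0 := null_sum P (fun i ↦ (he i).2) ct
  have hpw : ∀ γ : G, (p : ℤ) ∣ w γ := fun γ ↦ by
    rw [← ZMod.intCast_zmod_eq_zero_iff_dvd, hw]
    simp only [hct]
    rw [red_sum_val e c γ, hc, Pi.zero_apply]
  set w' : G → ℤ := fun γ ↦ w γ / p with hw'
  have hww' : ∀ γ : G, w γ = p * w' γ := fun γ ↦ (Int.mul_ediv_cancel' (hpw γ)).symm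
  have hw'add : ∀ γ δ : G, w' (γ * δ) = w' γ + w' δ := fun γ δ ↦ by
    apply mul_left_cancel₀ hp0
    rw [← hww', hwadd, hww', hww', mul_add]
  have hw'P : ∀ γ : G, P γ → w' γ = 0 := fun γ hγ ↦ by
    have h := hww' γ
    rw [hwP γ hγ] at h
    rcases mul_eq_zero.1 h.symm with h' | h'
    · exact absurd h' hp0
    · exact h'
  obtain ⟨d, hd, -⟩ := huniq w' hw'add hw'P
  obtain ⟨c₀, -, hc₀⟩ := huniq w hwadd hwP
  have h1 : ct = c₀ := hc₀ ct rfl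
  have h2 : (fun i ↦ (p : ℤ) * d i) = c₀ := hc₀ _ (by
    funext γ
    rw [hww' γ, hd, Finset.mul_sum]
    exact Finset.sum_congr rfl fun i _ ↦ by ring)
  have h3 : ct i = p * d i := by rw [h1, ← h2]
  have h4 : ((ct i : ℤ) : ZMod p) = 0 := by
    rw [h3, ZMod.intCast_zmod_eq_zero_iff_dvd]
    exact dvd_mul_right _ _
  simpa [hct, ZMod.natCast_zmod_val] using h4

/-- **THE LIFTING ENGINE**: a clause-(i) basis `e₁ … e_r` (additive, `P`-null, unique integral coefficients for every additive `P`-null map) together with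
the bound «every `𝔽_p`-linearly independent family of additive, torsion-null, `P`-null maps `G → ZMod p` has `≤ r` members» gives the lifting property at `p`: the
`r` reductions `ē i` are independent (`linearIndependent_red`), so adjoining `ψ` makes a dependent family, so `ψ = ∑ c i • ē i`; lift the coefficients.
[cite: ShimuraIATAF1971, §8.1 (8.1.4)–(8.1.6), §8.2 (8.2.6)] [cite: Iwaniec2002, Ch. 2 Prop. 2.6] -/
theorem modLift_of_basis (he : ∀ i, (∀ γ δ : G, e i (γ * δ) = e i γ + e i δ) ∧ ∀ γ : G, P γ → e i γ = 0)
    (huniq : ∀ u : G → ℤ, (∀ γ δ : G, u (γ * δ) = u γ + u δ) → (∀ γ : G, P γ → u γ = 0) →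
      ∃! c : Fin r → ℤ, u = fun γ ↦ ∑ i, c i * e i γ)
    (hV : ∀ (s : ℕ) (v : Fin s → G → ZMod p),
      (∀ i, (∀ γ δ : G, v i (γ * δ) = v i γ + v i δ) ∧ (∀ γ : G, IsOfFinOrder γ → v i γ = 0) ∧ (∀ γ : G, P γ → v i γ = 0)) →
      LinearIndependent (ZMod p) v → s ≤ r) :
    ∀ ψ : G → ZMod p,
      (∀ γ δ : G, ψ (γ * δ) = ψ γ + ψ δ) → (∀ γ : G, IsOfFinOrder γ → ψ γ = 0) → (∀ γ : G, P γ → ψ γ = 0) →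
      ∃ u : G → ℤ, (∀ γ δ : G, u (γ * δ) = u γ + u δ) ∧ (∀ γ : G, P γ → u γ = 0) ∧ ∀ γ : G, (u γ : ZMod p) = ψ γ := by
  intro ψ hadd htors hpar
  have hli := linearIndependent_red (p := p) P e he huniq
  -- the extended family `(ψ, ē₁, …, ē_r)` is additive, torsion-null, `P`-null, of size `r + 1`, hence dependent
  set v : Fin (r + 1) → G → ZMod p := Fin.cons (α := fun _ ↦ G → ZMod p) ψ (fun i ↦ red p (e i)) with hv
  have hprops : ∀ i : Fin (r + 1), (∀ γ δ : G, v i (γ * δ) = v i γ + v i δ) ∧ (∀ γ : G, IsOfFinOrder γ → v i γ = 0) ∧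
      (∀ γ : G, P γ → v i γ = 0) := by
    refine Fin.cases ?_ (fun i ↦ ?_)
    · simp only [hv, Fin.cons_zero]
      exact ⟨hadd, htors, hpar⟩
    · simp only [hv, Fin.cons_succ, red_apply]
      exact ⟨fun γ δ ↦ by rw [(he i).1, Int.cast_add], fun γ hγ ↦ by rw [additive_eq_zero_of_isOfFinOrder (he i).1 hγ, Int.cast_zero],
        fun γ hγ ↦ by rw [(he i).2 γ hγ, Int.cast_zero]⟩
  have hdep : ¬ LinearIndependent (ZMod p) v := fun h ↦ by
    have := hV (r + 1) v hprops h
    omega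
  rw [hv, linearIndependent_finCons, not_and, not_not] at hdep
  obtain ⟨c, hc⟩ := (Submodule.mem_span_range_iff_exists_fun (ZMod p)).1 (hdep hli)
  refine ⟨fun γ ↦ ∑ i, ((c i).val : ℤ) * e i γ, additive_sum (fun i ↦ (he i).1) _, null_sum P (fun i ↦ (he i).2) _, fun γ ↦ ?_⟩
  rw [red_sum_val e c γ, hc]

/-- Bookkeeping in the opposite direction: `t` `ℤ`-linearly independent additive `P`-null maps force `t ≤ r` (coefficient vectors in `ℤ^r`).
[cite: Iwaniec2002, Ch. 2 Prop. 2.6] -/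
theorem card_le_of_linearIndependent_int
    (huniq : ∀ u : G → ℤ, (∀ γ δ : G, u (γ * δ) = u γ + u δ) → (∀ γ : G, P γ → u γ = 0) →
      ∃! c : Fin r → ℤ, u = fun γ ↦ ∑ i, c i * e i γ)
    {t : ℕ} (f : Fin t → G → ℤ) (hf : ∀ j, (∀ γ δ : G, f j (γ * δ) = f j γ + f j δ) ∧ ∀ γ : G, P γ → f j γ = 0)
    (hli : LinearIndependent ℤ f) : t ≤ r := by
  choose C hC _ using fun j ↦ huniq (f j) (hf j).1 (hf j).2
  -- the coefficient rows are independent in `ℤ^r`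
  have hCli : LinearIndependent ℤ C := by
    rw [Fintype.linearIndependent_iff] at hli ⊢
    intro a ha
    refine hli a ?_
    funext γ
    have hrow : ∀ j, f j γ = ∑ i, C j i * e i γ := fun j ↦ by rw [hC j]
    calc (∑ j, a j • f j) γ = ∑ j, a j * ∑ i, C j i * e i γ := by
            rw [Finset.sum_apply]; exact Finset.sum_congr rfl fun j _ ↦ by rw [Pi.smul_apply, smul_eq_mul, hrow]
      _ = ∑ i, (∑ j, a j * C j i) * e i γ := by
            simp_rw [Finset.mul_sum, Finset.sum_mul]; rw [Finset.sum_comm]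
            exact Finset.sum_congr rfl fun i _ ↦ Finset.sum_congr rfl fun j _ ↦ by ring
      _ = ∑ i, (∑ j, a j • C j) i * e i γ := by
            refine Finset.sum_congr rfl fun i _ ↦ ?_
            rw [Finset.sum_apply]
            simp only [Pi.smul_apply, smul_eq_mul]
      _ = 0 := by rw [ha]; simp
  simpa using hCli.fintype_card_le_finrank

end Engine

/-! ## §4 The corollaries for (SIGᶜ)(ii) `parabolicCochain_modLift` -/

open Literature.NumberTheory.Automorphic

/-- **(SIGᶜ)(ii) FROM PRIME MODULI**: `parabolicCochain_modLift` follows from its restriction to prime `n` (`modLift_of_prime` at `G = ι(O¹)`,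
`P = IsParabolic ∘ (↑)`). [cite: ShimuraIATAF1971, §8.2 (8.2.6) p. 232] -/
theorem parabolicCochain_modLift_of_prime
    (h : ∀ (B : Type) [Ring B] [Algebra ℚ B] [IsQuaternionAlgebra ℚ B] (O : Submodule ℤ B) (hO : Brandt.IsOrder B O)
      (ι : B →ₐ[ℚ] Matrix (Fin 2) (Fin 2) ℝ), Function.Injective ι →
      ∀ (p : ℕ), p.Prime → ∀ ψ : normOneUnits ι hO → ZMod p,
        (∀ γ δ : normOneUnits ι hO, ψ (γ * δ) = ψ γ + ψ δ) →
        (∀ γ : normOneUnits ι hO, IsOfFinOrder γ → ψ γ = 0) →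
        (∀ γ : normOneUnits ι hO, (γ : GL (Fin 2) ℝ).IsParabolic → ψ γ = 0) →
        ∃ u : normOneUnits ι hO → ℤ,
          (∀ γ δ : normOneUnits ι hO, u (γ * δ) = u γ + u δ) ∧
          (∀ γ : normOneUnits ι hO, (γ : GL (Fin 2) ℝ).IsParabolic → u γ = 0) ∧
          ∀ γ : normOneUnits ι hO, (u γ : ZMod p) = ψ γ) :
    parabolicCochain_modLift := fun B _ _ _ O hO ι hι n hn ↦
  modLift_of_prime (fun γ : normOneUnits ι hO ↦ (γ : GL (Fin 2) ℝ).IsParabolic) (fun p hp ↦ h B O hO ι hι p hp) n hn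

/-- The converse projection: (SIGᶜ)(ii) ⇒ its prime-modulus restriction. [cite: ShimuraIATAF1971, §8.2 (8.2.6) p. 232] -/
theorem prime_of_parabolicCochain_modLift (h : parabolicCochain_modLift) :
    ∀ (B : Type) [Ring B] [Algebra ℚ B] [IsQuaternionAlgebra ℚ B] (O : Submodule ℤ B) (hO : Brandt.IsOrder B O)
      (ι : B →ₐ[ℚ] Matrix (Fin 2) (Fin 2) ℝ), Function.Injective ι →
      ∀ (p : ℕ), p.Prime → ∀ ψ : normOneUnits ι hO → ZMod p,
        (∀ γ δ : normOneUnits ι hO, ψ (γ * δ) = ψ γ + ψ δ) →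
        (∀ γ : normOneUnits ι hO, IsOfFinOrder γ → ψ γ = 0) →
        (∀ γ : normOneUnits ι hO, (γ : GL (Fin 2) ℝ).IsParabolic → ψ γ = 0) →
        ∃ u : normOneUnits ι hO → ℤ,
          (∀ γ δ : normOneUnits ι hO, u (γ * δ) = u γ + u δ) ∧
          (∀ γ : normOneUnits ι hO, (γ : GL (Fin 2) ℝ).IsParabolic → u γ = 0) ∧
          ∀ γ : normOneUnits ι hO, (u γ : ZMod p) = ψ γ :=
  fun B _ _ _ O hO ι hι p hp ↦ h B O hO ι hι p hp.ne_zero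

/-- **(SIGᶜ)(ii) ⇐ THE RANK BOUND**: if for every `(B, O, ι)` (`ι` injective), every prime `p` and every clause-(i) basis `e₁ … e_r` of
`Hom_par(ι(O¹), ℤ)`, each `𝔽_p`-linearly independent family of additive, torsion-null, parabolic-null maps `ι(O¹) → ZMod p` has at most `r` members
(«`dim_{𝔽_p} V_p ≤ rank_ℤ Hom_par`»), then (SIGᶜ)(ii) holds — clause (i) itself being the theorem `CartanCover.PrintClauses.sigBasisClause`.
[cite: ShimuraIATAF1971, §8.1 (8.1.4)–(8.1.6), §8.2 (8.2.6)] [cite: Iwaniec2002, Ch. 2 Prop. 2.6] -/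
theorem parabolicCochain_modLift_of_rankBound
    (hV : ∀ (B : Type) [Ring B] [Algebra ℚ B] [IsQuaternionAlgebra ℚ B] (O : Submodule ℤ B) (hO : Brandt.IsOrder B O)
      (ι : B →ₐ[ℚ] Matrix (Fin 2) (Fin 2) ℝ), Function.Injective ι →
      ∀ (p : ℕ), p.Prime → ∀ (r : ℕ) (e : Fin r → normOneUnits ι hO → ℤ),
        (∀ i, (∀ γ δ : normOneUnits ι hO, e i (γ * δ) = e i γ + e i δ) ∧
          ∀ γ : normOneUnits ι hO, (γ : GL (Fin 2) ℝ).IsParabolic → e i γ = 0) →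
        (∀ u : normOneUnits ι hO → ℤ,
          (∀ γ δ : normOneUnits ι hO, u (γ * δ) = u γ + u δ) →
          (∀ γ : normOneUnits ι hO, (γ : GL (Fin 2) ℝ).IsParabolic → u γ = 0) →
          ∃! c : Fin r → ℤ, u = fun γ ↦ ∑ i, c i * e i γ) →
        ∀ (s : ℕ) (v : Fin s → normOneUnits ι hO → ZMod p),
          (∀ i, (∀ γ δ : normOneUnits ι hO, v i (γ * δ) = v i γ + v i δ) ∧
            (∀ γ : normOneUnits ι hO, IsOfFinOrder γ → v i γ = 0) ∧
            (∀ γ : normOneUnits ι hO, (γ : GL (Fin 2) ℝ).IsParabolic → v i γ = 0)) →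
          LinearIndependent (ZMod p) v → s ≤ r) :
    parabolicCochain_modLift := by
  refine parabolicCochain_modLift_of_prime fun B _ _ _ O hO ι hι p hp ↦ ?_
  haveI : Fact p.Prime := ⟨hp⟩
  obtain ⟨r, e, he, huniq⟩ := CartanCover.PrintClauses.sigBasisClause O hO ι
  exact modLift_of_basis (fun γ : normOneUnits ι hO ↦ (γ : GL (Fin 2) ℝ).IsParabolic) e he huniq (hV B O hO ι hι p hp r e he huniq)

end Summit.BirchSwinnertonDyer.BirchSwinnertonDyer.Theorems.EichlerShimuraModLift

end
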